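import Summits.CriticalPhenomena.PercolationContinuityZ3.Theorems.PercNearOneGluingNoHeavyLowerTailSahiSlotTensorConeOrderTwo

/-!
# Harris's inequality on every product of a finite set, WITH AN EXPLICIT PIVOTAL-PAIR CERTIFICATE:
# `2^d·Cov(f₀,f₁) = Σ (nonnegative weights) × (parallel increment of f₀) × (parallel increment of f₁)`

Support file of the one-cut programme (crux `NoHeavyLowerTail`, stmt-CriticalPhenomena-4575; cell `prim-masterthm`, seat P3, gen 22;
`run/shared/lean/prim/prim-masterthm/prim-masterthm-p3/HIERARCHY.md` §30).  Pure proofs, no definitions, standard axioms.  Sequel of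
`…SahiSlotTensorConeOrderTwo` (`harrisForm_eq_sum_coverPairs`: the order-2 slot functional is a `0/1` sum of products of parallel cut edges)
and of the bridge `…SahiSlotPatternBridge` (`card_mul_sahiE_gridW_eq_sum_patternForm`: `|S_n^d|·E_n^{⊗g}(f) = Σ_r w(r)·patternForm(f ∘ slot_r)`).

THE THEOREM (`two_pow_mul_sahiE_two_gridW_eq_sum_increments`).  For every finite type `Y`, every `d`, every family of probability vectors
`g_a` on `Y` (product weight `gridW g` on `Fin d → Y`) and ANY two functions `f₀, f₁ : (Fin d → Y) → ℝ`:
  `2^d · (E[f₀f₁] − E[f₀]E[f₁]) = Σ_r w(r) Σ_t (f₀(x_t⁺) − f₀(x_t))·(f₁(y_t⁺) − f₁(y_t))`,   `w(r) = Π_a g_a(r_a 0)·g_a(r_a 1) ≥ 0`,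
where for each term the points `x_t⁺, x_t` differ ONLY in one coordinate `a_t`, in which the value `r_{a_t}(0)` is replaced by `r_{a_t}(1)`, and
`y_t⁺, y_t` differ in the SAME coordinate by the SAME two values (parallel increments; the pairs `(x_t, y_t)` come from the reflected-prefix cut-edge
pairs of the cube certificate).  This is the measure-level `n = 2` case of the pivotal-pair programme (memo FROM-prim-masterthm-p3-g21 §5(a),
"Cov ∈ C⊗C is a THEOREM") in closed finite form — no semigroup, no integral.
COROLLARY (`sahiE_two_gridW_nonneg_of_monotone`): on a product of finite CHAINS (`Y` linearly ordered) every term is a product of two parallel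
increments of monotone functions, hence `≥ 0`: Harris's inequality `E[f₀f₁] ≥ E[f₀]E[f₁]` for monotone `f₀, f₁` of any sign — a proof of
Harris by pivotal pairs (the tree has Harris/FKG via Mathlib's four-functions route: `Literature.Combinatorics.Sahi2008.sahiPositive_two`).
HONEST LABEL: order 2 only; nothing here bears on the open order-3 cells or on the pivotal-pair conjecture at order 3. [this work]
-/

noncomputable section

namespace Summit.CriticalPhenomena.PercolationContinuityZ3.Theorems

open Finset Function
open Literature.Combinatorics.Sahi2008

namespace SahiSlot

/-! ### The measure level: an explicit pivotal-pair certificate of Harris's inequality on every product of a finite set -/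

section HarrisCert

variable {d : ℕ} {Y : Type*} [Fintype Y]

omit [Fintype Y] in
/-- Slot maps commute with updating one cube coordinate. [this work] -/
theorem slotMap_update [DecidableEq Y] (r : Fin d → Fin 2 → Y) (ω : Q d 2) (a : Fin d) (v : Fin 2) :
    slotMap r (update ω a v) = update (slotMap r ω) a (r a v) := by
  funext b
  unfold slotMap
  by_cases h : b = a
  · subst h; simp only [update_self]
  · simp only [update_of_ne h]

/-- `|S_2^d| = 2^d`. [this work] -/
theorem card_perm_fin_two_pow : Fintype.card (Fin d → Equiv.Perm (Fin 2)) = 2 ^ d := by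
  rw [Fintype.card_fun, Fintype.card_perm, Fintype.card_fin, Fintype.card_fin]
  rfl

/-- **Harris's inequality with an explicit certificate, every product of a finite set.**  For a product probability weight
`gridW g` on `Fin d → Y` (any finite `Y`, coordinate laws `g_a`) and ANY two functions `f₀, f₁`:
`2^d · (E[f₀f₁] − E[f₀]E[f₁]) = Σ_r w(r) · Σ_t (f₀(x_t⁺) − f₀(x_t)) · (f₁(y_t⁺) − f₁(y_t))`, a finite sum with nonnegative weights
`w(r) = Π_a g_a(r_a 0) g_a(r_a 1)` over the slot maps `r`, in which `x_t⁺` differs from `x_t` ONLY in the coordinate `a_t`, where the value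
`r_{a_t}(0)` is replaced by `r_{a_t}(1)`, and `y_t⁺ / y_t` differ in the SAME coordinate by the SAME two values ("parallel increments").
(= the bridge `card_mul_sahiE_gridW_eq_sum_patternForm` at `n = 2` composed with the cut-edge certificate `harrisForm_eq_sum_coverPairs`.) [this work] -/
theorem two_pow_mul_sahiE_two_gridW_eq_sum_increments [DecidableEq Y] (g : Fin d → Y → ℝ) (hg : ∀ a, ∑ y, g a y = 1)
    (f : Fin 2 → (Fin d → Y) → ℝ) :
    ∃ (ι : Type) (_ : Fintype ι) (ω ω' : ι → Q d 2) (a : ι → Fin d), (∀ t, ω t (a t) = 0) ∧ (∀ t, ω' t (a t) = 0) ∧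
      (2:ℝ) ^ d * sahiE (gridW g) 2 f = ∑ r : Fin d → Fin 2 → Y, slotW g r *
        ∑ t, ((f 0 (update (slotMap r (ω t)) (a t) (r (a t) 1)) - f 0 (slotMap r (ω t))) *
              (f 1 (update (slotMap r (ω' t)) (a t) (r (a t) 1)) - f 1 (slotMap r (ω' t)))) := by
  obtain ⟨ι, hι, ω, ω', a, h1, h2, hid⟩ := harrisForm_eq_sum_coverPairs d
  refine ⟨ι, hι, ω, ω', a, h1, h2, ?_⟩
  have hb := card_mul_sahiE_gridW_eq_sum_patternForm g hg (show 1 ≤ 2 by norm_num) f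
  rw [card_perm_fin_two_pow] at hb
  push_cast at hb
  rw [hb]
  refine sum_congr rfl fun r _ => ?_
  congr 1
  rw [patternForm_two_eq_sum, hid]
  refine Fintype.sum_congr _ _ fun t => ?_
  simp only [comp_apply, slotMap_update]

/-- **Harris's inequality on a product of finite chains, by pivotal pairs** (corollary; no sign condition on the functions): every term of
the certificate is a product of two PARALLEL increments of monotone functions, hence `≥ 0`. [this work] -/
theorem sahiE_two_gridW_nonneg_of_monotone [LinearOrder Y] (g : Fin d → Y → ℝ) (hg0 : ∀ a y, 0 ≤ g a y) (hg : ∀ a, ∑ y, g a y = 1)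
    (f : Fin 2 → (Fin d → Y) → ℝ) (hf : ∀ i, Monotone (f i)) : 0 ≤ sahiE (gridW g) 2 f := by
  classical
  obtain ⟨ι, hι, ω, ω', a, h1, h2, hid⟩ := two_pow_mul_sahiE_two_gridW_eq_sum_increments g hg f
  have hpos : (0:ℝ) < (2:ℝ) ^ d := by positivity
  refine (mul_nonneg_iff_of_pos_left hpos).1 ?_
  rw [hid]
  refine sum_nonneg fun r _ => mul_nonneg (prod_nonneg fun b _ => prod_nonneg fun j _ => hg0 b _) (sum_nonneg fun t _ => ?_)
  -- the two increments are parallel: same coordinate `a t`, same pair of values `r (a t) 0 → r (a t) 1`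
  have hx : slotMap r (ω t) (a t) = r (a t) 0 := by unfold slotMap; rw [h1 t]
  have hy : slotMap r (ω' t) (a t) = r (a t) 0 := by unfold slotMap; rw [h2 t]
  rcases le_total (r (a t) 0) (r (a t) 1) with hle | hle
  · -- both increments go UP
    have hxle : slotMap r (ω t) ≤ update (slotMap r (ω t)) (a t) (r (a t) 1) :=
      le_update_iff.2 ⟨by rw [hx]; exact hle, fun b _ => le_rfl⟩
    have hyle : slotMap r (ω' t) ≤ update (slotMap r (ω' t)) (a t) (r (a t) 1) :=
      le_update_iff.2 ⟨by rw [hy]; exact hle, fun b _ => le_rfl⟩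
    exact mul_nonneg (sub_nonneg.2 (hf 0 hxle)) (sub_nonneg.2 (hf 1 hyle))
  · -- both increments go DOWN
    have hxle : update (slotMap r (ω t)) (a t) (r (a t) 1) ≤ slotMap r (ω t) :=
      update_le_iff.2 ⟨by rw [hx]; exact hle, fun b _ => le_rfl⟩
    have hyle : update (slotMap r (ω' t)) (a t) (r (a t) 1) ≤ slotMap r (ω' t) :=
      update_le_iff.2 ⟨by rw [hy]; exact hle, fun b _ => le_rfl⟩
    exact mul_nonneg_of_nonpos_of_nonpos (sub_nonpos.2 (hf 0 hxle)) (sub_nonpos.2 (hf 1 hyle))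

end HarrisCert

end SahiSlot

end Summit.CriticalPhenomena.PercolationContinuityZ3.Theorems
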